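import Summits.CriticalPhenomena.PercolationContinuityZ3.Theorems.Transplant.BoxProdZ2ConcParamsKit
import HarnessLib

/-!
# (S) The CONCRETE CHOICES of design (D) for `X □ ℤ²`: `concChoiceAt κ X hqt w p hT δA : ConcChoice κ X w p hT` assembled from the
# parameter toolkit and the inner-route accuracy `δA X κ hΔ := min_{n ≤ 1000 K} δUP n (δ₂²)` (§0), the choice function `concChoice₀ : ChoiceFn`,
# its well-formedness `wfHoldsFn_concChoice₀ : WFHoldsFn concChoice₀` (the unpacking of `AtQ` into
# the hypotheses of the raw residue theorems (R)/(F)/(C) is the companion file `BoxProdZ2ConcParamsAtQ`)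

builds on p205010 (kernel theorem, internal audit signed; external expert review pending) — nothing in this file uses p205010.
Status sentence (coordinator 2026-08-20T04:30Z): "θ(p_c) = 0 on ℤ^d, all d ≥ 2 — kernel-verified (Lean 4/Mathlib, standard axioms); internal adversarial
audit SIGNED 2026-08-20 04:29Z; external expert review pending."
Lane `prim-bschramm-*`, seat `prim-bschramm-stmt` (gen 6); helper file (`--supports stmt-CriticalPhenomena-4575`).
Parameter ledger: `run/shared/lean/prim/bschramm/prim-bschramm-stmt/CONC-PARAMS.md` (v1).

THE CHOICES at `(κ, X, w, p, hT)` (order of constants KN §4 pp. 25–31, refuter's D13/D14):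
* before `p`: `V₀ := reps X hqt`; `δA := min_{n ≤ nmaxA K} δUP X hΔ n (δ₂²)` (inner-route chain accuracy, `δUP_spec`); `δin := (δmin κ 44 δA)²`; `m₀ := 0`;
* at `p`, given the inner sizes `msel` and the threshold `M₀` (the kit scale `M := M₀`): `ψ := ufatRadius X hT V₀`, counts
  `k/N/L := kitK/N/L (Δ+4) (kitSB Δ M (ψ M)) (kitB Δ M (ψ M)) (δmin …) p`, `R' := M + L + 1`, cells `C := cellsOf K₀ R'` (`K = max 20 K₀`,
  `s = 400 (R'+1)`, `r = 4 t`, `t := tOf K₀ R'`), scales `S := Icc M (6 t)` — all `q`-FREE;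
* at the running `q`: `Rex q R₀' := excessRadiusAt X (insert w V₀) (25 r) (δmin/2) q R₀'`, inner tube radius `LA := 2 (ψ (6t) + ψ M) +
  Rex q (ψ (6 t))`, `L' := LA + ψ (6 t) + ψ M`, `E₀ := L'`, `gap := gapFn L' (Rex q)`, `Λ := concRadiiGB C gap (fun _ => 0) E₀ L'`.
* the UNPACKING of `AtQ` into the residue theorems' hypotheses is `BoxProdZ2ConcParamsAtQ` (next file).
[cite: KozmaNitzan2024, §4 Theorem 6 (pp. 25–31): the order of constants; Lemma 10 (pp. 17–21); Lemma 12 (p. 24)]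
-/

noncomputable section

open MeasureTheory
open scoped Classical

namespace Summit.CriticalPhenomena.PercolationContinuityZ3.Theorems

namespace Transplant

namespace BoxProdZ2

open Literature.Probability.Percolation Literature.Probability.LatticeModels SimpleGraph KNCells KNLevels
open Literature.Probability.Percolation.GM (HOct piece)
open Literature.Barriers.CriticalPhenomena (IsQuasiTransitive IsGraphAmenable)

/-! ## §0 The inner-route accuracy (fixed before `p`: a function of `κ` and the fibre graph only; lead g3 16:11:23Z) -/

section InnerAcc

variable {W : Type} [DecidableEq W] [Countable W] (X : SimpleGraph W) [X.LocallyFinite]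

/-- **The chain accuracy of `chain_edge_tube_UP`** for chains of `n + 1` steps delivering `1 - ε` (`1` off `0 < ε`). [this work] -/
def δUP {Δ : ℕ} (hΔ : ∀ w, X.degree w ≤ Δ) (n : ℕ) (ε : ℝ) : ℝ :=
  if hε : 0 < ε then Classical.choose (chain_edge_tube_UP X hΔ n hε) else 1

/-- `0 < δUP`. [folklore] -/
theorem δUP_pos {Δ : ℕ} (hΔ : ∀ w, X.degree w ≤ Δ) (n : ℕ) (ε : ℝ) : 0 < δUP X hΔ n ε := by
  unfold δUP; split_ifs with hε
  · exact (Classical.choose_spec (chain_edge_tube_UP X hΔ n hε)).1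
  · exact one_pos

/-- `δUP ≤ 1`. [folklore] -/
theorem δUP_le_one {Δ : ℕ} (hΔ : ∀ w, X.degree w ≤ Δ) (n : ℕ) (ε : ℝ) : δUP X hΔ n ε ≤ 1 := by
  unfold δUP; split_ifs with hε
  · exact (Classical.choose_spec (chain_edge_tube_UP X hΔ n hε)).2.1
  · exact le_rfl

/-- **Specification of `δUP`**: the conclusion of `chain_edge_tube_UP X hΔ n hε` (every `q < 1`, every window `π`, every weighting) at the
accuracy `δUP X hΔ n ε` — the `hchain` hypothesis of `innerRoute_lt` / `lt_real_of_advRChain` / `hreach_of_tubeChain`. [cite: KozmaNitzan2024, §4 Lemma 12 (pp. 23–25)] -/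
theorem δUP_spec {Δ : ℕ} (hΔ : ∀ w, X.degree w ≤ Δ) (n : ℕ) {ε : ℝ} (hε : 0 < ε) :
    ∀ (q : unitInterval), (q : ℝ) < 1 →
      ∀ (π : Finset W) (Wt : Sym2 (W × Site 2) → unitInterval) (s : Fin (n + 1) → TStep (tubeGraph X π))
      (T' : Fin (n + 1) → Finset (W × Site 2)) (η : ℝ),
      (∀ i : Fin (n + 1), (s i).L.o = (s 0).L.o) →
      (∀ i : Fin n, T' (Fin.castSucc i) ⊆ (s i.succ).L.X 0) →
      (∀ i : Fin (n + 1), T' i ⊆ (s i).T) →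
      (∀ i : Fin (n + 1), (s i).KitsAt Wt q (Δ + 4) (δUP X hΔ n ε)) →
      η ≤ δUP X hΔ n ε / 2 →
      (∀ i : Fin (n + 1), (prodBernoulli Wt).real (⋃ t ∈ (s i).T \ T' i, openConn (s 0).L.o t) ≤ η) →
      1 - δUP X hΔ n ε < (prodBernoulli Wt).real (s 0).L.reachB →
        1 - ε < (prodBernoulli Wt).real (⋃ t ∈ T' (Fin.last n), openConn (s 0).L.o t) := by
  have e : δUP X hΔ n ε = Classical.choose (chain_edge_tube_UP X hΔ n hε) := by unfold δUP; rw [dif_pos hε]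
  rw [e]
  exact (Classical.choose_spec (chain_edge_tube_UP X hΔ n hε)).2.2

omit [DecidableEq W] [Countable W] [X.LocallyFinite] in
/-- **The maximal inner chain length served**: `1000 K` advances (the inner runs of the face step have `nA ≤ 23 r / s₁A ≤ 184 K` for
`s₁A ≥ s / 8`; p3-g3's `advRoute_of_contact`). [this work] -/
def nmaxA (K : ℕ) : ℕ := 1000 * K

/-- **The inner-route accuracy** `δA := min_{n ≤ nmaxA K} δUP n (δ₂²)` (`K = max 20 K₀`): one accuracy below the chain accuracy of every
inner chain length, fixed before `p`. [this work] -/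
def δA (κ : ConcConsts) (hΔ : ∀ w, X.degree w ≤ κ.Δ) : ℝ :=
  ((Finset.range (nmaxA (Kof κ.K₀) + 1)).image fun n => δUP X hΔ n (κ.δ₂ ^ 2)).min'
    ⟨δUP X hΔ 0 (κ.δ₂ ^ 2), Finset.mem_image.2 ⟨0, by simp, rfl⟩⟩

/-- `δA ≤ δUP n (δ₂²)` for every inner chain length `n ≤ nmaxA K`. [folklore] -/
theorem δA_le_δUP (κ : ConcConsts) (hΔ : ∀ w, X.degree w ≤ κ.Δ) {n : ℕ} (hn : n ≤ nmaxA (Kof κ.K₀)) :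
    δA X κ hΔ ≤ δUP X hΔ n (κ.δ₂ ^ 2) :=
  Finset.min'_le _ _ (Finset.mem_image.2 ⟨n, Finset.mem_range.2 (Nat.lt_succ_of_le hn), rfl⟩)

/-- `0 < δA`. [folklore] -/
theorem δA_pos (κ : ConcConsts) (hΔ : ∀ w, X.degree w ≤ κ.Δ) : 0 < δA X κ hΔ := by
  unfold δA
  refine (Finset.lt_min'_iff _ _).2 fun y hy => ?_
  obtain ⟨n, -, rfl⟩ := Finset.mem_image.1 hy
  exact δUP_pos X hΔ n _

/-- `δA ≤ 1`. [folklore] -/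
theorem δA_le_one (κ : ConcConsts) (hΔ : ∀ w, X.degree w ≤ κ.Δ) : δA X κ hΔ ≤ 1 :=
  (δA_le_δUP X κ hΔ (Nat.zero_le _)).trans (δUP_le_one X hΔ 0 _)

end InnerAcc

/-! ## §1 The concrete choices at `(κ, X, w, p, hT)` -/

namespace Conc

section Defs

variable (κ : ConcConsts) {W : Type} [DecidableEq W] [Countable W] (X : SimpleGraph W) [X.LocallyFinite] (hqt : IsQuasiTransitive X)
  (w : W) (p : unitInterval) (hT : TubeSubcritical X p) (δA : ℝ)

/-- The root-chain length index: the root run has `44` advances (p2-g2's `RootRunOK`, `nA := 44`). [this work] -/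
def nR : ℕ := 44

/-- The uniform fat radius at `p` over the representatives. [folklore] -/
abbrev ψ (n : ℕ) : ℕ := ufatRadius X hT (reps X hqt) n

/-- The number of seeds `k` (at accuracy `δmin`, kit scale `M`). [folklore] -/
def kc (M : ℕ) : ℕ := kitK (κ.Δ + 4) (kitSB κ.Δ M (ψ X hqt p hT M)) (kitB κ.Δ M (ψ X hqt p hT M)) (δmin κ nR δA) p

/-- The number of contacts `N`. [folklore] -/
def Nc (M : ℕ) : ℕ := kitN (κ.Δ + 4) (kitSB κ.Δ M (ψ X hqt p hT M)) (kitB κ.Δ M (ψ X hqt p hT M)) (δmin κ nR δA) p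

/-- The number of levels `L`. [folklore] -/
def Lc (M : ℕ) : ℕ := kitL (κ.Δ + 4) (kitSB κ.Δ M (ψ X hqt p hT M)) (kitB κ.Δ M (ψ X hqt p hT M)) (δmin κ nR δA) p

/-- The neighbourhood radius `R' := M + L + 1` (one more than the top level `Rlev = M + L`). [this work] -/
def R'c (M : ℕ) : ℕ := M + Lc κ X hqt p hT δA M + 1

/-- The planar cells `C := cellsOf K₀ R'`. [this work] -/
def Cc (M : ℕ) : PCells := cellsOf κ.K₀ (R'c κ X hqt p hT δA M)

/-- The chain unit `t` (`r = 4 t`). [this work] -/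
def tc (M : ℕ) : ℕ := tOf κ.K₀ (R'c κ X hqt p hT δA M)

/-- The planar scales `S := Icc M (6 t)` (kit scale `M`, route scales `M + 1, …, 6 t`). [this work] -/
def Sc (M : ℕ) : Finset ℕ := Finset.Icc M (6 * tc κ X hqt p hT δA M)

/-- The excess tolerance `η := δmin / 2`. [this work] -/
def ηc : ℝ := δmin κ nR δA / 2

/-- The excess radius at the running parameter over `insert w (reps X hqt)`, planar size `25 r`. [this work] -/
def Rexc (M : ℕ) (q : unitInterval) (R₀' : ℕ) : ℕ :=
  excessRadiusAt X (insert w (reps X hqt)) (25 * (Cc κ X hqt p hT δA M).r) (ηc κ δA) q R₀'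

/-- The inner tube radius of the face step's elongated routes: `2 (ψ (6t) + ψ M) + Rex q (ψ (6 t))`. [this work] -/
def LAc (M : ℕ) (q : unitInterval) : ℕ :=
  2 * (ψ X hqt p hT (6 * tc κ X hqt p hT δA M) + ψ X hqt p hT M) + Rexc κ X hqt w p hT δA M q (ψ X hqt p hT (6 * tc κ X hqt p hT δA M))

/-- The collar width `L' := LA + ψ (6 t) + ψ M`. [this work] -/
def L'c (M : ℕ) (q : unitInterval) : ℕ :=
  LAc κ X hqt w p hT δA M q + ψ X hqt p hT (6 * tc κ X hqt p hT δA M) + ψ X hqt p hT M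

/-- The root seed radius `E₀ := L'`. [this work] -/
def E₀c (M : ℕ) (q : unitInterval) : ℕ := L'c κ X hqt w p hT δA M q

/-- The gap function `gap := gapFn L' (Rex q)`. [this work] -/
def gapc (M : ℕ) (q : unitInterval) : ℕ → ℕ := gapFn (L'c κ X hqt w p hT δA M q) (Rexc κ X hqt w p hT δA M q)

/-- The radius schedule `Λ := concRadiiGB C gap 0 E₀ L'`. [this work] -/
def Λc (M : ℕ) (q : unitInterval) : ConcRadiiG :=
  concRadiiGB (Cc κ X hqt p hT δA M) (gapc κ X hqt w p hT δA M q) (fun _ => 0) (E₀c κ X hqt w p hT δA M q) (L'c κ X hqt w p hT δA M q)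

end Defs

/-- **The concrete choices at `(κ, X, w, p, hT)`** with inner accuracy `δA > 0`. [this work] -/
def choiceAt (κ : ConcConsts) {W : Type} [DecidableEq W] [Countable W] (X : SimpleGraph W) [X.LocallyFinite] (hqt : IsQuasiTransitive X)
    (w : W) (p : unitInterval) (hT : TubeSubcritical X p) {δA : ℝ} (hδA : 0 < δA) : ConcChoice κ X w p hT where
  V₀ := reps X hqt
  δin := δmin κ nR δA ^ 2
  m₀ := 0
  S := fun _ M₀ => Sc κ X hqt p hT δA M₀
  C := fun _ M₀ _ => Cc κ X hqt p hT δA M₀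
  Λ := fun _ M₀ q => Λc κ X hqt w p hT δA M₀ q
  δin_pos := δmin_sq_pos κ nR hδA
  S_ge := fun _ _ _ _ hM => le_of_mem_Icc_scales hM

end Conc

/-! ## §2 The choice function and its well-formedness -/

/-- **THE CONCRETE CHOICE FUNCTION** of design (D): `Conc.choiceAt` with the inner accuracy `δA X κ hΔ`. [cite: KozmaNitzan2024, §4 Theorem 6 (pp. 25–31)] -/
def concChoice₀ : ChoiceFn :=
  fun κ _ _ _ X _ hΔ _ hqt _ _ w p _ _ hT => Conc.choiceAt κ X hqt w p hT (δA_pos X κ hΔ)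

/-- `concChoice₀` unfolds to `Conc.choiceAt` (by `rfl`). [folklore] -/
theorem concChoice₀_eq (κ : ConcConsts) {W : Type} [DecidableEq W] [Countable W] (X : SimpleGraph W) [X.LocallyFinite]
    (hΔ : ∀ v, X.degree v ≤ κ.Δ) (hc : X.Connected) (hqt : IsQuasiTransitive X) (ha : IsGraphAmenable X) (hinf : Infinite W) (w : W)
    (p : unitInterval) (hp0 : 0 < (p : ℝ)) (hp1 : (p : ℝ) < 1) (hT : TubeSubcritical X p) :
    concChoice₀ κ X hΔ hc hqt ha hinf w p hp0 hp1 hT = Conc.choiceAt κ X hqt w p hT (δA_pos X κ hΔ) := rfl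

/-- **The concrete choices are well formed**: `Λ.WF C` (`concRadiiGB_WF`) and `K₀ ≤ C.K` (`K = max 20 K₀`). [this work] -/
theorem wfHoldsFn_concChoice₀ : WFHoldsFn concChoice₀ := by
  intro κ W _ _ X _ hΔ hc hqt ha hinf w p hp0 hp1 hT msel M₀ q _
  exact ⟨concRadiiGB_WF _ _ _ _ _, K₀_le_cellsOf_K _ _⟩

end BoxProdZ2

end Transplant

end Summit.CriticalPhenomena.PercolationContinuityZ3.Theorems

end
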